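/-
Soloist programme `solo-KontsevichZagierPeriods-blind`, session 3.
KONTSEVICH–ZAGIER'S EQ. (1) COMPLETED, II: the rational half-angle chart and `kz_eq_one`.
-/
import Summits.KontsevichZagierPeriods.KontsevichZagierPeriods.Theorems.SoloBlindPiGraphsReps
import HarnessLib

/-!
# Kontsevich–Zagier's eq. (1), II: all four representations of `π` are equivalent under the rules

## Main results

* `exists_arcsineChart`, `equivalent_prod_arcsine` — ONE move: the **rational** chart
  `Θ(u,v) = ((1-u²)/(1+u²), v(1+u²)/(2u))` maps `(0,∞) × (0,1]` injectively ONTO the region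
  `A = {x² < 1, 0 < y, y²(1-x²) ≤ 1}` under the graph of `1/√(1-x²)`, with `|det DΘ| = 2/(1+u²)`,
  so `[(0,∞), 2/(1+u²)] × [(0,1], 1] ≡ [A, 1]` (the half-angle substitution `x = cos θ`,
  `u = tan(θ/2)`, done without trigonometry); the integrability of `1` on `A` is *transported*
  along the chart.
* `arcsineRep_value_eq_cauchyLine_value`, `halfEllipseRep_value = π` — read off from the moves.
* `kz_eq_one` — **all four members of eq. (1) are pairwise KZ-equivalent** by finitely many
  instances of rules (1)–(2) with `ℚ`-rational data (via the tame `π`-sector, `kz_piSector`).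

No analytic input beyond `∫ du/(1+u²)` (Mathlib).
-/

noncomputable section

namespace Summit.KontsevichZagierPeriods.KontsevichZagierPeriods.Theorems

open Set MeasureTheory
open Literature.ModelTheory.ExponentialFields (IsSemialgebraic isSemialgebraic_setOf_eval_pos
  isSemialgebraic_setOf_eval_le isSemialgebraic_setOf_eval_lt)
open MvPolynomial (aeval X)
open Literature.NumberTheory.Transcendental
open Literature.NumberTheory.Transcendental.KZ

namespace SoloBlind

/-! ## The rational arcsine chart `Θ(u,v) = ((1-u²)/(1+u²), v(1+u²)/(2u))` -/

/-- **The rational half-angle chart.**  `Θ` maps the slab `(0,∞) × (0,1]` injectively ONTO the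
region `A` under the graph of `1/√(1-x²)`, with `|det DΘ(u,v)| = 2/(1+u²)`: it straightens the
algebraic arc `y²(1-x²) = 1` (`x = (1-u²)/(1+u²)` has `√(1-x²) = 2u/(1+u²)`). -/
theorem exists_arcsineChart :
    ∃ (Θ : (Fin 2 → ℝ) → (Fin 2 → ℝ)) (Θ' : (Fin 2 → ℝ) → (Fin 2 → ℝ) →L[ℝ] (Fin 2 → ℝ)),
      IsSemialgebraicMapOn ℚ kzSlab Θ ∧ (∀ z ∈ kzSlab, HasFDerivAt Θ (Θ' z) z) ∧
      InjOn Θ kzSlab ∧ Θ '' kzSlab = kzArcsine ∧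
      (∀ z ∈ kzSlab, |(Θ' z).det| = 2 / (1 + z 0 ^ 2)) := by
  set Θ : (Fin 2 → ℝ) → (Fin 2 → ℝ) :=
    fun z => ![(1 - z 0 ^ 2) / (1 + z 0 ^ 2), z 1 * (1 + z 0 ^ 2) / (2 * z 0)] with hΘ
  set Θ' : (Fin 2 → ℝ) → (Fin 2 → ℝ) →L[ℝ] (Fin 2 → ℝ) :=
    fun z => LinearMap.toContinuousLinearMap (Matrix.toLin'
      !![-(4 * z 0) / (1 + z 0 ^ 2) ^ 2, 0;
         z 1 * (z 0 ^ 2 - 1) / (2 * z 0 ^ 2), (1 + z 0 ^ 2) / (2 * z 0)]) with hΘ'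
  have hΘ0 : ∀ z, Θ z 0 = (1 - z 0 ^ 2) / (1 + z 0 ^ 2) := fun z => rfl
  have hΘ1 : ∀ z, Θ z 1 = z 1 * (1 + z 0 ^ 2) / (2 * z 0) := fun z => rfl
  have hΘ'0 : ∀ z v : Fin 2 → ℝ, Θ' z v 0 = -(4 * z 0) / (1 + z 0 ^ 2) ^ 2 * v 0 := by
    intro z v
    change Matrix.toLin' !![-(4 * z 0) / (1 + z 0 ^ 2) ^ 2, 0;
      z 1 * (z 0 ^ 2 - 1) / (2 * z 0 ^ 2), (1 + z 0 ^ 2) / (2 * z 0)] v 0 = _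
    rw [Matrix.toLin'_apply]
    simp [Matrix.mulVec, dotProduct, Fin.sum_univ_two]
  have hΘ'1 : ∀ z v : Fin 2 → ℝ, Θ' z v 1 =
      z 1 * (z 0 ^ 2 - 1) / (2 * z 0 ^ 2) * v 0 + (1 + z 0 ^ 2) / (2 * z 0) * v 1 := by
    intro z v
    change Matrix.toLin' !![-(4 * z 0) / (1 + z 0 ^ 2) ^ 2, 0;
      z 1 * (z 0 ^ 2 - 1) / (2 * z 0 ^ 2), (1 + z 0 ^ 2) / (2 * z 0)] v 1 = _
    rw [Matrix.toLin'_apply]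
    simp [Matrix.mulVec, dotProduct, Fin.sum_univ_two]
  have hdet : ∀ z : Fin 2 → ℝ, z 0 ≠ 0 → (Θ' z).det = -(2 / (1 + z 0 ^ 2)) := by
    intro z hz0
    have hq : (1:ℝ) + z 0 ^ 2 ≠ 0 := by positivity
    change LinearMap.det (Matrix.toLin' !![-(4 * z 0) / (1 + z 0 ^ 2) ^ 2, 0;
      z 1 * (z 0 ^ 2 - 1) / (2 * z 0 ^ 2), (1 + z 0 ^ 2) / (2 * z 0)]) = _
    rw [LinearMap.det_toLin', Matrix.det_fin_two]
    simp only [Matrix.of_apply, Matrix.cons_val', Matrix.cons_val_zero, Matrix.cons_val_one,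
      Matrix.cons_val_fin_one, Matrix.empty_val']
    field_simp
    ring
  have hderiv : ∀ z : Fin 2 → ℝ, 0 < z 0 → HasFDerivAt Θ (Θ' z) z := by
    intro z hz0
    have hq : (1:ℝ) + z 0 ^ 2 ≠ 0 := by positivity
    have hq' : (1:ℝ) + z 0 * z 0 ≠ 0 := by rw [← pow_two]; exact hq
    have h2 : (2:ℝ) * z 0 ≠ 0 := by positivity
    have h0 : HasFDerivAt (fun y : Fin 2 → ℝ => y 0)
        (ContinuousLinearMap.proj (R := ℝ) (φ := fun _ : Fin 2 => ℝ) 0) z := hasFDerivAt_apply 0 z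
    have h1 : HasFDerivAt (fun y : Fin 2 → ℝ => y 1)
        (ContinuousLinearMap.proj (R := ℝ) (φ := fun _ : Fin 2 => ℝ) 1) z := hasFDerivAt_apply 1 z
    have hden := (h0.mul h0).const_add 1
    have hinv := (hasFDerivAt_inv hq').comp z hden
    have hinv2 := (hasFDerivAt_inv h2).comp z (h0.const_mul 2)
    rw [hasFDerivAt_pi']
    refine Fin.forall_fin_two.mpr ⟨?_, ?_⟩
    · have hf : (fun y : Fin 2 → ℝ => Θ y 0) = fun y => (1 - y 0 * y 0) * (1 + y 0 * y 0)⁻¹ :=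
        funext fun y => by rw [hΘ0, div_eq_mul_inv, pow_two]
      rw [hf]
      refine (((h0.mul h0).const_sub 1).mul hinv).congr_fderiv
        (ContinuousLinearMap.ext fun v => ?_)
      simp [hΘ'0]
      field_simp
      ring
    · have hf : (fun y : Fin 2 → ℝ => Θ y 1) =
          fun y => y 1 * (1 + y 0 * y 0) * (2 * y 0)⁻¹ :=
        funext fun y => by rw [hΘ1, div_eq_mul_inv, pow_two]
      rw [hf]
      refine ((h1.mul hden).mul hinv2).congr_fderiv (ContinuousLinearMap.ext fun v => ?_)
      simp [hΘ'1]
      field_simp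
      ring
  refine ⟨Θ, Θ', ?_, fun z hz => hderiv z hz.1, ?_, ?_, fun z hz => ?_⟩
  · refine IsSemialgebraicMapOn.of_forall ?_ (Fin.forall_fin_two.mpr ⟨?_, ?_⟩)
    · exact prod_twoAtan_unitIoc_domain ▸ (twoAtanHalfLine.prod unitIoc).isSemialgebraic_domain
    · refine (isSemialgebraicFunOn_aeval_div_aeval
        (prod_twoAtan_unitIoc_domain ▸ (twoAtanHalfLine.prod unitIoc).isSemialgebraic_domain)
        (1 - X 0 ^ 2) (1 + X 0 ^ 2) fun x _ => ?_).congr fun x _ => by simp [hΘ0]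
      have : (0:ℝ) < 1 + x 0 ^ 2 := by positivity
      simpa using this.ne'
    · refine (isSemialgebraicFunOn_aeval_div_aeval
        (prod_twoAtan_unitIoc_domain ▸ (twoAtanHalfLine.prod unitIoc).isSemialgebraic_domain)
        (X 1 * (1 + X 0 ^ 2)) (2 * X 0) fun x hx => ?_).congr fun x _ => by simp [hΘ1]
      rw [mem_kzSlab] at hx
      simpa using hx.1.ne'
  · intro x hx y hy hxy
    have e0 := congrFun hxy 0
    have e1 := congrFun hxy 1
    simp only [hΘ0, hΘ1] at e0 e1
    rw [mem_kzSlab] at hx hy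
    have hy2 : (2:ℝ) * y 0 ≠ 0 := (mul_pos two_pos hy.1).ne'
    have hqx : (0:ℝ) < 1 + x 0 ^ 2 := by positivity
    have hqy : (0:ℝ) < 1 + y 0 ^ 2 := by positivity
    rw [div_eq_div_iff hqx.ne' hqy.ne'] at e0
    have h4 : x 0 ^ 2 = y 0 ^ 2 := by linear_combination (-(1:ℝ) / 2) * e0
    have h5 : (x 0 - y 0) * (x 0 + y 0) = 0 := by linear_combination h4
    have h00 : x 0 = y 0 := by
      rcases mul_eq_zero.mp h5 with h | h
      · linarith
      · linarith [hx.1, hy.1]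
    rw [h00, div_eq_div_iff hy2 hy2] at e1
    have h11 : x 1 = y 1 := by
      have := mul_right_cancel₀ hy2 e1
      exact mul_right_cancel₀ hqy.ne' this
    funext i
    fin_cases i
    · exact h00
    · exact h11
  · ext w
    constructor
    · rintro ⟨z, hz, rfl⟩
      rw [mem_kzSlab] at hz
      obtain ⟨ha, hv, hv1⟩ := hz
      have hq : (0:ℝ) < 1 + z 0 ^ 2 := by positivity
      rw [mem_kzArcsine]
      simp only [hΘ0, hΘ1]
      refine ⟨?_, by positivity, ?_⟩
      · rw [div_pow, div_lt_one (pow_pos hq 2)]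
        nlinarith [pow_pos ha 2]
      · have h : (z 1 * (1 + z 0 ^ 2) / (2 * z 0)) ^ 2 * (1 - ((1 - z 0 ^ 2) / (1 + z 0 ^ 2)) ^ 2)
            = z 1 ^ 2 := by
          field_simp
          ring
        rw [h]
        exact pow_le_one₀ hv.le hv1
    · intro hw
      rw [mem_kzArcsine] at hw
      obtain ⟨hw0, hw1, hw⟩ := hw
      obtain ⟨hl, hr⟩ := abs_lt.mp ((sq_lt_one_iff_abs_lt_one (w 0)).mp hw0)
      have hp : (0:ℝ) < 1 + w 0 := by linarith
      have hm : (0:ℝ) < 1 - w 0 := by linarith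
      set a : ℝ := Real.sqrt ((1 - w 0) / (1 + w 0)) with ha_def
      have ha : 0 < a := Real.sqrt_pos.mpr (div_pos hm hp)
      have ha2 : a ^ 2 = (1 - w 0) / (1 + w 0) := Real.sq_sqrt (div_pos hm hp).le
      have h1a : 1 + a ^ 2 = 2 / (1 + w 0) := by
        rw [ha2]
        field_simp
        ring
      have hx : (1 - a ^ 2) / (1 + a ^ 2) = w 0 := by
        rw [ha2]
        field_simp
        ring
      have hv2 : (a * w 1 * (1 + w 0)) ^ 2 = w 1 ^ 2 * (1 - w 0 ^ 2) := by
        rw [mul_pow, mul_pow, ha2]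
        field_simp
        ring
      have hv : 0 < a * w 1 * (1 + w 0) := mul_pos (mul_pos ha hw1) hp
      refine ⟨![a, a * w 1 * (1 + w 0)], ?_, ?_⟩
      · rw [mem_kzSlab]
        refine ⟨ha, hv, ?_⟩
        change a * w 1 * (1 + w 0) ≤ 1
        exact (pow_le_one_iff_of_nonneg hv.le two_ne_zero).mp (hv2 ▸ hw)
      · funext i
        fin_cases i
        · exact hx
        · change a * w 1 * (1 + w 0) * (1 + a ^ 2) / (2 * a) = w 1
          rw [h1a]
          field_simp
  · rw [mem_kzSlab] at hz
    rw [hdet z hz.1.ne', abs_neg]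
    exact abs_of_pos (by positivity)

/-- The constant `1` is integrable on the arcsine region — transported along `Θ` from the
integrability of `2/(1+u²)` on the slab (no estimate of `∫ dx/√(1-x²)` needed). -/
theorem integrableOn_one_kzArcsine : IntegrableOn (fun _ : Fin 2 → ℝ => (1 : ℝ)) kzArcsine := by
  obtain ⟨Θ, Θ', -, hderiv, hinj, himage, hdet⟩ := exists_arcsineChart
  rw [← himage]
  refine (integrableOn_iff_of_chart ?_ hderiv hinj hdet (f := fun z => 2 / (1 + z 0 ^ 2))
    (fun z _ => (one_mul _).symm)).mpr ?_
  · rw [← prod_twoAtan_unitIoc_domain]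
    exact (twoAtanHalfLine.prod unitIoc).isSemialgebraic_domain.measurableSet_holds
  · have h := (twoAtanHalfLine.prod unitIoc).integrableOn
    rw [prod_twoAtan_unitIoc_domain] at h
    exact h.congr_fun (fun z _ => prod_twoAtan_unitIoc_integrand z)
      (prod_twoAtan_unitIoc_domain ▸ (twoAtanHalfLine.prod unitIoc).isSemialgebraic_domain
        |>.measurableSet_holds)

/-- **`A = [{x² < 1, 0 < y, y²(1-x²) ≤ 1}, 1]`**: `∫_{-1}^{1} dx/√(1-x²)` as a subgraph area. -/
def arcsineRep : IntegralRep 2 :=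
  ratRep kzArcsine (fun _ => 1) 1 1 isSemialgebraic_kzArcsine (fun _ _ => by simp)
    (fun _ _ => by simp) integrableOn_one_kzArcsine

/-- `A` has KZ's literal rational shape. -/
theorem isRational_arcsineRep : arcsineRep.IsRational := isRational_ratRep

/-- **Move (change of variables): `T × I ≡ A`** along the rational half-angle chart:
`2/(1+u²) = 1 · |det DΘ|`. -/
theorem equivalent_prod_arcsine : Equivalent (twoAtanHalfLine.prod unitIoc) arcsineRep := by
  obtain ⟨Θ, Θ', hsa, hderiv, hinj, himage, hdet⟩ := exists_arcsineChart
  exact equivalent_of_chart hsa hderiv hinj himage hdet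
    (f := fun z : Fin 2 → ℝ => 2 / (1 + z 0 ^ 2)) (g := fun _ : Fin 2 → ℝ => (1 : ℝ))
    (fun _ _ => (one_mul _).symm) prod_twoAtan_unitIoc_domain
    (fun z _ => prod_twoAtan_unitIoc_integrand z) rfl (fun _ _ => rfl)

/-! ## Consequences: eq. (1) in full -/

/-- `A` lies in the tame `π`-sector `M_π`. -/
theorem of_arcsineRep_mem_piSector : of arcsineRep ∈ piSector := by
  have h1 : of twoAtanHalfLine ∈ piSector :=
    lineRing_pi_le_piSector (NonUnitalSubring.subset_closure of_twoAtanHalfLine_mem_lineGens)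
  have h2 : of unitIoc ∈ piSector :=
    lineRing_pi_le_piSector (NonUnitalSubring.subset_closure of_unitIoc_mem_lineGens)
  rw [mem_piSector] at h1 h2 ⊢
  rw [← mkQ_eq_mkQ_iff.mpr equivalent_prod_arcsine, ← of_mul_of, mkQ_mul]
  exact mul_mem h1 h2

/-- `E` lies in `M_π`. -/
theorem of_halfEllipseRep_mem_piSector : of halfEllipseRep ∈ piSector := by
  rw [mem_piSector, mkQ_eq_mkQ_iff.mpr halfEllipse_sub_disc, ← mem_piSector]
  exact of_discRep_mem_piSector

/-- **The arcsine region and the Cauchy line have the same value** (`∫_{-1}^{1} dx/√(1-x²) = π`,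
move-theoretically): the area under `1/√(1-x²)` is read off from the chart move and
`∫₀^∞ 2du/(1+u²) = π`; combine with `cauchyLine_value` for `= π`. -/
theorem arcsineRep_value_eq_cauchyLine_value : arcsineRep.value = cauchyLine.value := by
  rw [cauchyLine_value]
  have h := relations_le_ker_eval_holds equivalent_prod_arcsine
  rw [AddMonoidHom.mem_ker, map_sub, eval_of, eval_of, IntegralRep.value_prod,
    twoAtanHalfLine_value, unitIoc_value, sub_eq_zero] at h
  rw [← h, mul_one]

/-- **`2∫_{-1}^{1} √(1-x²) dx = π`, move-theoretically.** -/
theorem halfEllipseRep_value : halfEllipseRep.value = Real.pi := by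
  have h := relations_le_ker_eval_holds halfEllipse_sub_disc
  rw [AddMonoidHom.mem_ker, map_sub, eval_of, eval_of, discRep_value_eq_cauchyLine_value,
    cauchyLine_value, sub_eq_zero] at h
  exact h

/-- **Kontsevich–Zagier's eq. (1) in full, inside the rules.**  All four representations of `π`
in *Periods*, eq. (1) — the disc, `2∫_{-1}^{1} √(1-x²) dx` and `∫_{-1}^{1} dx/√(1-x²)` (as areas
under their algebraic graphs, with `ℚ`-rational data), and `∫_{-∞}^{∞} dx/(1+x²)` — are pairwise
equivalent under finitely many instances of rules (1) (additivity) and (2) (change of variables)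
with `ℚ`-rational data. -/
theorem kz_eq_one :
    Equivalent discRep halfEllipseRep ∧ Equivalent halfEllipseRep arcsineRep ∧
      Equivalent arcsineRep cauchyLine :=
  ⟨kz_piSector _ _ of_discRep_mem_piSector of_halfEllipseRep_mem_piSector
      (by rw [discRep_value_eq_cauchyLine_value, cauchyLine_value, halfEllipseRep_value]),
    kz_piSector _ _ of_halfEllipseRep_mem_piSector of_arcsineRep_mem_piSector
      (by rw [halfEllipseRep_value, arcsineRep_value_eq_cauchyLine_value, cauchyLine_value]),
    kz_piSector _ _ of_arcsineRep_mem_piSector of_cauchyLine_mem_piSector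
      arcsineRep_value_eq_cauchyLine_value⟩

/-- Pinned form: ANY representation on the arcsine region with integrand `1` is equivalent to ANY
representation on the disc with integrand `1`. -/
theorem kz_arcsine_disc_pinned (r r' : IntegralRep 2) (hrd : r.domain = kzArcsine)
    (hri : ∀ z ∈ r.domain, r.integrand z = 1) (hr'd : r'.domain = kzDisc)
    (hr'i : ∀ z ∈ r'.domain, r'.integrand z = 1) : Equivalent r r' := by
  have h1 : of r - of arcsineRep ∈ relations :=
    of_sub_of_mem_relations_of_eqOn hrd.symm fun z hz => hri z hz
  have h2 : of discRep - of r' ∈ relations :=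
    of_sub_of_mem_relations_of_eqOn hr'd fun z hz => (hr'i z (hr'd ▸ hz)).symm
  have h3 : Equivalent arcsineRep discRep :=
    kz_piSector _ _ of_arcsineRep_mem_piSector of_discRep_mem_piSector
      (by rw [arcsineRep_value_eq_cauchyLine_value, discRep_value_eq_cauchyLine_value])
  have h := add_mem (add_mem h1 h3) h2
  unfold Equivalent at h ⊢
  convert h using 1
  abel

end SoloBlind

end Summit.KontsevichZagierPeriods.KontsevichZagierPeriods.Theorems
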